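import Literature.AlgebraicGeometry.Modules.CechPushforward
import Literature.AlgebraicGeometry.Modules.PullbackFlatMono
import Mathlib.RingTheory.TensorProduct.IsBaseChangePi
import Mathlib.AlgebraicGeometry.Morphisms.Affine
import HarnessLib

/-!
# The base-change comparison for Čech complexes `θ• : q^* g₀_* Č•(𝓤, N₀) ⟶ g'_* Č•(π'⁻¹𝓤, π'^*N₀)`
# along a cartesian square, and its value on pulled-back sections
# (Hartshorne III Prop. 9.3 (proof); The Stacks Project, Tags 02KG, 02KH)

Layer `Literature/AlgebraicGeometry/Modules`. For a cartesian square of schemes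

  `Z' —g'→ P`, `Z' —π'→ Z₀`, `P —q→ Y`, `Z₀ —g₀→ Y`, `g' ≫ q = π' ≫ g₀` (`hsq : IsPullback g' π' q g₀`),

a family `𝓤 = (U_i)` of opens of `Z₀` with pulled-back family `𝓤' = π'⁻¹𝓤` of `Z'`, and an `𝒪_{Z₀}`-module `N₀`,
Hartshorne's proof of flat base change (III.9.3) compares the Čech complexes of `N₀` and of `π'^*N₀`:

* §1 algebra: a `B`-linear map between two base changes `B ⊗_A M` compatible with the structure maps is
  bijective (`bijective_of_isBaseChange`); base change along a cocartesian square of rings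
  (`isBaseChange_of_isPushout`, Mathlib `Algebra.IsPushout.cancelBaseChange`);
* §2 **`isBaseChange_unitSectionLE`**: for ANY morphism `f : X ⟶ Y`, affine opens `U ⊆ f⁻¹V`, and an
  affine-localizing `M`, the sections `Γ(U, f^*M)` are the BASE CHANGE `Γ(U) ⊗_{Γ(V)} Γ(V, M)` in Mathlib's
  `IsBaseChange` currency, with structure map `m ↦ η(m)|_U` (`Modules/PullbackAffineChart.chartSectionsEquiv`,
  Görtz–Wedhorn I Prop. 7.24 (2));
* §3 the faces of `𝓤'` are affine over `P` when those of `𝓤` are affine over `Y`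
  (`isAffineHom_face_preimageFamily_ι_comp`, base change of affine morphisms);
* §4 **the comparison**: `Cech.unitHom` (`Čⁿ(𝓤, N₀) ⟶ π'_* Čⁿ(𝓤', π'^*N₀)`, from the unit `N₀ → π'_*π'^*N₀`
  and `Modules/CechPushforward.pushforwardObjIso`), `exchangeIso hsq : π'_* ⋙ g₀_* ≅ g'_* ⋙ q_*`,
  `baseChangeFlat` (`g₀_* Čⁿ ⟶ q_* g'_* Č'ⁿ`), **`baseChangeHom hsq U N₀ n : q^* g₀_* Čⁿ(𝓤, N₀) ⟶ g'_* Čⁿ(𝓤', π'^*N₀)`**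
  (adjoint transpose), their compatibility with the Čech differentials (`Cech.map_d`, `baseChangeHom_d`) and
  **`baseChangeHom_app_unitSectionLE`**: on a pulled-back section `η_q(m)|_W`, `m = (m_α)_α ∈ Π_α Γ(N₀, g₀⁻¹V ∩ U_α)`,
  the value of `θⁿ` is `(η_{π'}(m_α)|_{g'⁻¹W ∩ U'_α})_α` — the formula from which `Modules/CechBaseChange` proves
  that `θⁿ` is an isomorphism for finite relatively-affine covers (both sides are base changes of
  `Π_α Γ(N₀, g₀⁻¹V ∩ U_α)`).

Everything PROVED; 0 named facts; no instances (algebra structures on rings of sections are bound with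
`letI` inside statements). Typed for the cell `pub-hodge-ring2` (brick (K4) «derived flat base change»); a research
route conditional on HC_CM, not a corollary — nothing in this file refers to it.

## References

* R. Hartshorne, *Algebraic Geometry*, GTM 52 (1977), III Prop. 9.3 and its proof (flat base change via Čech
  complexes), II Prop. 5.8, II §5 p. 110 (`f^*`). [Hartshorne1977]
* The Stacks Project, Tags 02KG (affine base change), 02KH (flat base change), 02KE. [StacksProject]
* U. Görtz, T. Wedhorn, *Algebraic Geometry I*, 2nd ed. (2020), Prop. 7.24 (2). [GortzWedhorn2020]
-/

noncomputable section

-- `TopCat.Presheaf`/`Scheme.Modules` are not reducible (as in Mathlib's `AlgebraicGeometry/Modules/Sheaf.lean`).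
set_option backward.isDefEq.respectTransparency false

universe u

open CategoryTheory CategoryTheory.Limits Opposite TopologicalSpace AlgebraicGeometry TensorProduct
open scoped ChangeOfRings

namespace Literature.AlgebraicGeometry.Modules

open Literature.AlgebraicGeometry.Motives (Scheme.Modules.Hom.app_map_apply)

/-! ### §1 Algebra: maps between base changes -/

section Algebra

variable {A B : Type*} [CommRing A] [CommRing B] [Algebra A B]
  {M S T : Type*} [AddCommGroup M] [Module A M] [AddCommGroup S] [Module A S] [Module B S] [IsScalarTower A B S]
  [AddCommGroup T] [Module A T] [Module B T] [IsScalarTower A B T]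

/-- **A `B`-linear map between two base changes of the same `A`-module to `B`, compatible with the structure
maps, is bijective** (uniqueness of the base change up to unique isomorphism).
[cite: StacksProject, Tag 02KG (proof: both sides are `B ⊗_A M`)] -/
theorem bijective_of_isBaseChange (j₁ : M →ₗ[A] S) (j₂ : M →ₗ[A] T) (h₁ : IsBaseChange B j₁)
    (h₂ : IsBaseChange B j₂) (θ : S →ₗ[B] T) (hθ : ∀ m, θ (j₁ m) = j₂ m) : Function.Bijective θ := by
  have key : θ ∘ₗ h₁.equiv.toLinearMap = h₂.equiv.toLinearMap := by
    apply TensorProduct.AlgebraTensorModule.ext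
    intro b m
    simp [IsBaseChange.equiv_tmul, hθ]
  have hθ' : (θ : S → T) = h₂.equiv ∘ h₁.equiv.symm := by
    funext x
    have := congrArg (fun f => f (h₁.equiv.symm x)) key
    simpa using this
  rw [hθ']
  exact h₂.equiv.bijective.comp h₁.equiv.symm.bijective

variable {A' B' : Type*} [CommRing A'] [CommRing B'] [Algebra A A'] [Algebra B B'] [Algebra A' B'] [Algebra A B']
  [IsScalarTower A A' B'] [IsScalarTower A B B'] [Algebra.IsPushout A B A' B']
  {N T' : Type*} [AddCommGroup N] [Module A' N] [Module A N] [IsScalarTower A A' N]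
  [AddCommGroup T'] [Module A' T'] [Module B' T'] [IsScalarTower A' B' T'] [Module A T'] [Module B T']
  [IsScalarTower A A' T'] [IsScalarTower B B' T'] [IsScalarTower A B T']

/-- **Base change along a cocartesian square of rings**: if `B' = B ⊗_A A'` and `T' = B' ⊗_{A'} N`, then
`T' = B ⊗_A N` (Mathlib `Algebra.IsPushout.cancelBaseChange`). [cite: StacksProject, Tag 02KG (proof)] -/
theorem isBaseChange_of_isPushout (j : N →ₗ[A'] T') (hj : IsBaseChange B' j) :
    IsBaseChange B (j.restrictScalars A) := by
  refine IsBaseChange.of_equiv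
    ((Algebra.IsPushout.cancelBaseChange A B A' B' N).symm ≪≫ₗ hj.equiv.restrictScalars B) fun x => ?_
  simp [IsBaseChange.equiv_tmul]

end Algebra

/-! ### §2 `Γ(U, f^*M)` is the base change `Γ(U) ⊗_{Γ(V)} Γ(V, M)` -/

section Chart

variable {X Y : Scheme.{u}} (f : X ⟶ Y) (M : Y.Modules) {V : Y.Opens} {U : X.Opens} (i : U ≤ f ⁻¹ᵁ V)

/-- **The pulled-back sections `m ↦ η(m)|_U` as a `Γ(V)`-linear map `Γ(V, M) → Γ(U, f^*M)`**, for the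
`Γ(V)`-module structure on `Γ(U, f^*M)` through `f♯ : Γ(V) → Γ(U)`. [cite: Hartshorne1977, II §5 p. 110] -/
def unitSectionLEₗ :
    letI : Module Γ(Y, V) Γ((Scheme.Modules.pullback f).obj M, U) := Module.compHom _ (f.appLE V U i).hom
    Γ(M, V) →ₗ[Γ(Y, V)] Γ((Scheme.Modules.pullback f).obj M, U) :=
  letI : Module Γ(Y, V) Γ((Scheme.Modules.pullback f).obj M, U) := Module.compHom _ (f.appLE V U i).hom
  { toFun := unitSectionLE f M i
    map_add' := unitSectionLE_add f M i
    map_smul' := fun r m => unitSectionLE_smul f M i r m }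

/-- `unitSectionLEₗ` is `unitSectionLE` (definitional). [cite: Hartshorne1977, II §5 p. 110] -/
theorem unitSectionLEₗ_apply (m : Γ(M, V)) : unitSectionLEₗ f M i m = unitSectionLE f M i m := rfl

/-- **`Γ(U, f^*M) = Γ(U) ⊗_{Γ(V)} Γ(V, M)`** in `IsBaseChange` currency: for `M` affine-localizing and affine
`U ⊆ f⁻¹V`, `V` affine, `m ↦ η(m)|_U` exhibits `Γ(U, f^*M)` as the base change of `Γ(V, M)` along
`f♯ : Γ(V) → Γ(U)` (Görtz–Wedhorn I Prop. 7.24 (2), `chartSectionsEquiv`). [cite: GortzWedhorn2020, Prop 7.24 (2)]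
[cite: Hartshorne1977, II Prop. 5.2 (e) (p. 110)] -/
theorem isBaseChange_unitSectionLE (hV : IsAffineOpen V) (hU : IsAffineOpen U) (hM : IsAffineLocalizing M) :
    letI := (f.appLE V U i).hom.toAlgebra
    letI : Module Γ(Y, V) Γ((Scheme.Modules.pullback f).obj M, U) := Module.compHom _ (f.appLE V U i).hom
    haveI : IsScalarTower Γ(Y, V) Γ(X, U) Γ((Scheme.Modules.pullback f).obj M, U) :=
      ⟨fun a b x => mul_smul ((f.appLE V U i).hom a) b x⟩
    IsBaseChange Γ(X, U) (unitSectionLEₗ f M i) := by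
  letI := (f.appLE V U i).hom.toAlgebra
  letI : Module Γ(Y, V) Γ((Scheme.Modules.pullback f).obj M, U) := Module.compHom _ (f.appLE V U i).hom
  haveI : IsScalarTower Γ(Y, V) Γ(X, U) Γ((Scheme.Modules.pullback f).obj M, U) :=
    ⟨fun a b x => mul_smul ((f.appLE V U i).hom a) b x⟩
  let e₁ : Γ(X, U) ⊗[Γ(Y, V)] Γ(M, V) ≃ₗ[Γ(X, U)] chartTensor f M hV i :=
    (appTopRestrictFromSpecEquiv M hV).baseChange Γ(Y, V) Γ(X, U) _ _
  let e₂ : chartTensor f M hV i ≃ₗ[Γ(X, U)] Γ((Scheme.Modules.pullback f).obj M, U) :=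
    { chartSectionsEquiv f M hV hU i hM with
      map_smul' := fun c q => chartSectionsEquiv_smul f M hV hU i hM c q }
  refine IsBaseChange.of_equiv (e₁ ≪≫ₗ e₂) fun m => ?_
  change chartSectionsEquiv f M hV hU i hM (e₁ (1 ⊗ₜ m)) = unitSectionLE f M i m
  rw [show e₁ (1 ⊗ₜ m) = (1 : Γ(X, U)) ⊗ₜ[Γ(Y, V), (chartHom f i).hom] (appTopRestrictFromSpecEquiv M hV m) from
    LinearEquiv.baseChange_tmul _ _ _ _ _ _, chartSectionsEquiv_one_tmul]

end Chart

/-! ### §3 Faces of the pulled-back cover are affine over the new base -/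

section Faces

variable {Z₀ Z' P Y : Scheme.{u}} {g₀ : Z₀ ⟶ Y} {q : P ⟶ Y} {π' : Z' ⟶ Z₀} {g' : Z' ⟶ P}
  (hsq : IsPullback g' π' q g₀)
include hsq

/-- For an open `F ⊆ Z₀`, the square `π'⁻¹F → P`, `π'⁻¹F → F` over `q`, `F → Y` is cartesian (pasting the
restriction square of `π'` with `hsq`). [cite: StacksProject, Tag 02KG (proof)] -/
theorem isPullback_preimage_ι_comp (F : Z₀.Opens) :
    IsPullback ((π' ⁻¹ᵁ F).ι ≫ g') (π' ∣_ F) q (F.ι ≫ g₀) :=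
  (isPullback_morphismRestrict π' F).flip.paste_horiz hsq

/-- **Affine morphisms are stable under base change, on the pieces**: if `F → Y` is affine then so is
`π'⁻¹F → P`. [cite: StacksProject, Tag 02KG (proof: base change of an affine morphism is affine)] -/
theorem isAffineHom_preimage_ι_comp (F : Z₀.Opens) [IsAffineHom (F.ι ≫ g₀)] : IsAffineHom ((π' ⁻¹ᵁ F).ι ≫ g') :=
  MorphismProperty.of_isPullback (isPullback_preimage_ι_comp hsq F).flip inferInstance

/-- The faces of `π'⁻¹𝓤` are affine over `P` when the faces of `𝓤` are affine over `Y`.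
[cite: Hartshorne1977, III Prop. 9.3 (proof)] [cite: StacksProject, Tag 02KG] -/
theorem isAffineHom_face_preimageFamily_ι_comp {ι : Type u} (U : ι → Z₀.Opens)
    (hUaff : ∀ {m : ℕ} (β : Fin (m + 1) → ι), IsAffineHom ((face U β).ι ≫ g₀)) {m : ℕ} (β : Fin (m + 1) → ι) :
    IsAffineHom ((face (Cech.preimageFamily π' U) β).ι ≫ g') := by
  haveI := hUaff β
  haveI := isAffineHom_preimage_ι_comp hsq (face U β)
  have e : face (Cech.preimageFamily π' U) β = π' ⁻¹ᵁ face U β := Cech.face_preimageFamily π' U β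
  rw [← Z'.isoOfEq_hom_ι e, Category.assoc]
  infer_instance

end Faces

/-! ### §4 The comparison morphism `θ• : q^* g₀_* Č•(𝓤, N₀) ⟶ g'_* Č•(π'⁻¹𝓤, π'^*N₀)` -/

namespace Cech

variable {X : Scheme.{u}} {ι : Type u} (U : ι → X.Opens) {M N : X.Modules} (φ : M ⟶ N)

/-- `Čⁿ(𝓤, φ)` commutes with the Čech differentials. [cite: Hartshorne1977, III Lemma 4.2 (functoriality of `𝒞•(𝔘, ℱ)`)] -/
@[reassoc]
theorem map_d (n : ℕ) : map U n M φ ≫ d U N n = d U M n ≫ map U (n + 1) M φ := by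
  simp only [d, Preadditive.comp_sum, Preadditive.sum_comp, Linear.comp_smul, Linear.smul_comp, structMap_map]

/-- **`Č•(𝓤, φ) : Č•(𝓤, M) ⟶ Č•(𝓤, N)`** as a cochain map. [cite: Hartshorne1977, III Lemma 4.2 (functoriality of `𝒞•(𝔘, ℱ)`)] -/
def complexMap : complex U M ⟶ complex U N :=
  CochainComplex.ofHom (fun n => map U n M φ) fun n => by
    rw [complex_d, complex_d]; exact map_d U φ n

/-- Components of `complexMap`. [cite: Hartshorne1977, III Lemma 4.2] -/
@[simp] theorem complexMap_f (n : ℕ) : (complexMap U φ).f n = map U n M φ := rfl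

end Cech

section Comparison

variable {Z₀ Z' P Y : Scheme.{u}} {g₀ : Z₀ ⟶ Y} {q : P ⟶ Y} {π' : Z' ⟶ Z₀} {g' : Z' ⟶ P}
  (hsq : IsPullback g' π' q g₀) {ι : Type u} (U : ι → Z₀.Opens) (N₀ : Z₀.Modules)

namespace Cech

/-- **`Čⁿ(𝓤, N₀) ⟶ π'_* Čⁿ(π'⁻¹𝓤, π'^*N₀)`**: `Čⁿ` of the unit `N₀ → π'_*π'^*N₀` followed by the exchange
`Čⁿ(𝓤, π'_*M') ≅ π'_* Čⁿ(π'⁻¹𝓤, M')`; on sections `(s_α)_α ↦ (η(s_α))_α`. [cite: Hartshorne1977, III Prop. 9.3 (proof)] -/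
def unitHom (π' : Z' ⟶ Z₀) (n : ℕ) :
    obj U n N₀ ⟶ (Scheme.Modules.pushforward π').obj
      (obj (preimageFamily π' U) n ((Scheme.Modules.pullback π').obj N₀)) :=
  map U n N₀ (pullbackUnit π' N₀) ≫ (pushforwardObjIso π' U n ((Scheme.Modules.pullback π').obj N₀)).inv

/-- `unitHom` commutes with the Čech differentials. [cite: Hartshorne1977, III Prop. 9.3 (proof)] -/
theorem unitHom_d (π' : Z' ⟶ Z₀) (n : ℕ) :
    unitHom U N₀ π' n ≫ (Scheme.Modules.pushforward π').map (d (preimageFamily π' U) ((Scheme.Modules.pullback π').obj N₀) n) =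
      d U N₀ n ≫ unitHom U N₀ π' (n + 1) := by
  have h := pushforwardObjHom_d π' U n ((Scheme.Modules.pullback π').obj N₀)
  have h' : (pushforwardObjIso π' U n ((Scheme.Modules.pullback π').obj N₀)).inv ≫
      (Scheme.Modules.pushforward π').map (d (preimageFamily π' U) ((Scheme.Modules.pullback π').obj N₀) n) =
      d U ((Scheme.Modules.pushforward π').obj ((Scheme.Modules.pullback π').obj N₀)) n ≫
        (pushforwardObjIso π' U (n + 1) ((Scheme.Modules.pullback π').obj N₀)).inv := by
    rw [Iso.inv_comp_eq, ← Category.assoc, Iso.eq_comp_inv]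
    exact h
  rw [unitHom, unitHom, Category.assoc, h', ← Category.assoc, map_d, Category.assoc]

/-- Sections of `unitHom`, read back through the exchange: the `α`-component of
`pushforwardObjHom (unitHom s)` is `η(s_α)`. [cite: Hartshorne1977, III Prop. 9.3 (proof)] -/
theorem pushforwardObjHom_app_unitHom_app (π' : Z' ⟶ Z₀) (n : ℕ) (O : Z₀.Opens) (s : Γ(obj U n N₀, O))
    (α : Fin (n + 1) → ι) :
    ((pushforwardObjHom π' U n ((Scheme.Modules.pullback π').obj N₀)).app O ((unitHom U N₀ π' n).app O s) :
        Sections U n ((Scheme.Modules.pushforward π').obj ((Scheme.Modules.pullback π').obj N₀)) O) α =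
      unitSection π' N₀ (O ⊓ face U α) ((s : Sections U n N₀ O) α) := by
  rw [unitHom, Scheme.Modules.Hom.comp_app, CategoryTheory.comp_apply, ← CategoryTheory.comp_apply,
    ← Scheme.Modules.Hom.comp_app, pushforwardObjIso, asIso_inv, IsIso.inv_hom_id, Scheme.Modules.Hom.id_app]
  exact map_app_apply U n N₀ (pullbackUnit π' N₀) O s α

end Cech

/-- **The exchange `g₀_* π'_* ≅ q_* g'_*`** of direct images along the commutative square `g' ≫ q = π' ≫ g₀`
(Mathlib `pushforwardComp`, `pushforwardCongr`). [cite: Hartshorne1977, III Prop. 9.3 (proof)] -/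
def exchangeIso : Scheme.Modules.pushforward π' ⋙ Scheme.Modules.pushforward g₀ ≅
    Scheme.Modules.pushforward g' ⋙ Scheme.Modules.pushforward q :=
  Scheme.Modules.pushforwardComp π' g₀ ≪≫ Scheme.Modules.pushforwardCongr hsq.w.symm ≪≫
    (Scheme.Modules.pushforwardComp g' q).symm

/-- Sections of the exchange: a transport along `g'⁻¹(q⁻¹V) = π'⁻¹(g₀⁻¹V)`. [cite: Hartshorne1977, III Prop. 9.3 (proof)] -/
theorem exchangeIso_hom_app_app (B : Z'.Modules) (V : Y.Opens) (x : Γ(B, π' ⁻¹ᵁ (g₀ ⁻¹ᵁ V))) :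
    ((exchangeIso hsq).hom.app B).app V x =
      B.presheaf.map (eqToHom (show g' ⁻¹ᵁ (q ⁻¹ᵁ V) = π' ⁻¹ᵁ (g₀ ⁻¹ᵁ V) by
        rw [← Scheme.Hom.comp_preimage, ← Scheme.Hom.comp_preimage, hsq.w])).op x := by
  simp only [exchangeIso, Iso.trans_hom, Iso.symm_hom, NatTrans.comp_app, Scheme.Modules.Hom.comp_app,
    CategoryTheory.comp_apply, Scheme.Modules.pushforwardComp_hom_app_app, Scheme.Modules.pushforwardComp_inv_app_app,
    Scheme.Modules.pushforwardCongr_hom_app_app]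
  rfl

variable (n : ℕ)

/-- **`g₀_* Čⁿ(𝓤, N₀) ⟶ q_* g'_* Čⁿ(π'⁻¹𝓤, π'^*N₀)`**: `g₀_*` of `Cech.unitHom` followed by the exchange.
[cite: Hartshorne1977, III Prop. 9.3 (proof)] -/
def baseChangeFlat :
    (Scheme.Modules.pushforward g₀).obj (Cech.obj U n N₀) ⟶
      (Scheme.Modules.pushforward q).obj ((Scheme.Modules.pushforward g').obj
        (Cech.obj (Cech.preimageFamily π' U) n ((Scheme.Modules.pullback π').obj N₀))) :=
  (Scheme.Modules.pushforward g₀).map (Cech.unitHom U N₀ π' n) ≫ (exchangeIso hsq).hom.app _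

/-- **The base-change comparison `θⁿ : q^* g₀_* Čⁿ(𝓤, N₀) ⟶ g'_* Čⁿ(π'⁻¹𝓤, π'^*N₀)`** (adjoint transpose of
`baseChangeFlat` for `q^* ⊣ q_*`). [cite: Hartshorne1977, III Prop. 9.3 (proof)] [cite: StacksProject, Tag 02KH] -/
def baseChangeHom :
    (Scheme.Modules.pullback q).obj ((Scheme.Modules.pushforward g₀).obj (Cech.obj U n N₀)) ⟶
      (Scheme.Modules.pushforward g').obj (Cech.obj (Cech.preimageFamily π' U) n ((Scheme.Modules.pullback π').obj N₀)) :=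
  ((Scheme.Modules.pullbackPushforwardAdjunction q).homEquiv _ _).symm (baseChangeFlat hsq U N₀ n)

/-- `baseChangeFlat` commutes with the Čech differentials. [cite: Hartshorne1977, III Prop. 9.3 (proof)] -/
theorem baseChangeFlat_d :
    baseChangeFlat hsq U N₀ n ≫ (Scheme.Modules.pushforward q).map ((Scheme.Modules.pushforward g').map
      (Cech.d (Cech.preimageFamily π' U) ((Scheme.Modules.pullback π').obj N₀) n)) =
    (Scheme.Modules.pushforward g₀).map (Cech.d U N₀ n) ≫ baseChangeFlat hsq U N₀ (n + 1) := by
  rw [baseChangeFlat, baseChangeFlat, Category.assoc]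
  have hnat := (exchangeIso hsq).hom.naturality (Cech.d (Cech.preimageFamily π' U) ((Scheme.Modules.pullback π').obj N₀) n)
  simp only [Functor.comp_map] at hnat
  rw [← hnat, ← Category.assoc, ← Functor.map_comp, Cech.unitHom_d, Functor.map_comp, Category.assoc]

/-- **`θ•` commutes with the Čech differentials**: `θⁿ ≫ g'_*(d') = q^*(g₀_* d) ≫ θⁿ⁺¹`.
[cite: Hartshorne1977, III Prop. 9.3 (proof)] -/
theorem baseChangeHom_d :
    baseChangeHom hsq U N₀ n ≫ (Scheme.Modules.pushforward g').map
      (Cech.d (Cech.preimageFamily π' U) ((Scheme.Modules.pullback π').obj N₀) n) =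
    (Scheme.Modules.pullback q).map ((Scheme.Modules.pushforward g₀).map (Cech.d U N₀ n)) ≫ baseChangeHom hsq U N₀ (n + 1) := by
  rw [baseChangeHom, baseChangeHom, ← Adjunction.homEquiv_naturality_right_symm, baseChangeFlat_d,
    Adjunction.homEquiv_naturality_left_symm]

/-- **`θ• : q^* g₀_* Č•(𝓤, N₀) ⟶ g'_* Č•(π'⁻¹𝓤, π'^*N₀)` as a cochain map.** [cite: Hartshorne1977, III Prop. 9.3 (proof)] -/
def baseChangeComplexHom :
    ((Scheme.Modules.pushforward g₀ ⋙ Scheme.Modules.pullback q).mapHomologicalComplex (ComplexShape.up ℕ)).obj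
        (Cech.complex U N₀) ⟶
      ((Scheme.Modules.pushforward g').mapHomologicalComplex (ComplexShape.up ℕ)).obj
        (Cech.complex (Cech.preimageFamily π' U) ((Scheme.Modules.pullback π').obj N₀)) :=
  CochainComplex.ofHom (fun n => baseChangeHom hsq U N₀ n) fun n => by
    change baseChangeHom hsq U N₀ n ≫ (Scheme.Modules.pushforward g').map ((Cech.complex _ _).d n (n + 1)) =
      (Scheme.Modules.pullback q).map ((Scheme.Modules.pushforward g₀).map ((Cech.complex U N₀).d n (n + 1))) ≫ _
    rw [Cech.complex_d, Cech.complex_d]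
    exact baseChangeHom_d hsq U N₀ n

/-- Components of `baseChangeComplexHom`. [cite: Hartshorne1977, III Prop. 9.3 (proof)] -/
@[simp] theorem baseChangeComplexHom_f (k : ℕ) : (baseChangeComplexHom hsq U N₀).f k = baseChangeHom hsq U N₀ k := rfl

/-! ### The value of `θⁿ` on pulled-back sections -/

/-- The transpose evaluated on a pulled-back section: `θ(η_q(m)) = θ♭(m)` over `q⁻¹V`.
[cite: Hartshorne1977, II §5 p. 110 (`f^* ⊣ f_*`)] -/
theorem baseChangeHom_app_unitSection (V : Y.Opens)
    (m : Γ((Scheme.Modules.pushforward g₀).obj (Cech.obj U n N₀), V)) :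
    (baseChangeHom hsq U N₀ n).app (q ⁻¹ᵁ V) (unitSection q _ V m) = (baseChangeFlat hsq U N₀ n).app V m := by
  have h : baseChangeFlat hsq U N₀ n =
      (Scheme.Modules.pullbackPushforwardAdjunction q).homEquiv _ _ (baseChangeHom hsq U N₀ n) := by
    rw [baseChangeHom, Equiv.apply_symm_apply]
  rw [h, Adjunction.homEquiv_unit, Scheme.Modules.Hom.comp_app, CategoryTheory.comp_apply,
    Scheme.Modules.pushforward_map_app]
  rfl

include hsq in
/-- An inequality of opens used below: `g'⁻¹W ∩ U'_α ≤ π'⁻¹(g₀⁻¹V ∩ U_α)` for `W ≤ q⁻¹V`.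
[cite: Hartshorne1977, III Prop. 9.3 (proof)] -/
theorem preimage_inf_face_le {V : Y.Opens} {W : P.Opens} (i : W ≤ q ⁻¹ᵁ V) {m : ℕ} (α : Fin (m + 1) → ι) :
    g' ⁻¹ᵁ W ⊓ face (Cech.preimageFamily π' U) α ≤ π' ⁻¹ᵁ (g₀ ⁻¹ᵁ V ⊓ face U α) := by
  rw [Cech.preimage_inf_face π' U]
  refine inf_le_inf_right _ ((g'.preimage_mono i).trans (le_of_eq ?_))
  rw [← Scheme.Hom.comp_preimage, ← Scheme.Hom.comp_preimage, hsq.w]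

/-- **The value of `θⁿ` on a pulled-back section**: for `W ≤ q⁻¹V` and
`m = (m_α)_α ∈ Γ(V, g₀_* Čⁿ(𝓤, N₀)) = Π_α Γ(N₀, g₀⁻¹V ∩ U_α)`, the `α`-component of `θⁿ(η_q(m)|_W)` is
`η_{π'}(m_α)|_{g'⁻¹W ∩ U'_α}`. [cite: Hartshorne1977, III Prop. 9.3 (proof)] [cite: StacksProject, Tag 02KG] -/
theorem baseChangeHom_app_unitSectionLE {V : Y.Opens} {W : P.Opens} (i : W ≤ q ⁻¹ᵁ V)
    (m : Γ((Scheme.Modules.pushforward g₀).obj (Cech.obj U n N₀), V)) (α : Fin (n + 1) → ι) :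
    ((show Γ(Cech.obj (Cech.preimageFamily π' U) n ((Scheme.Modules.pullback π').obj N₀), g' ⁻¹ᵁ W) from
        (baseChangeHom hsq U N₀ n).app W (unitSectionLE q _ i m)) :
        Cech.Sections (Cech.preimageFamily π' U) n ((Scheme.Modules.pullback π').obj N₀) (g' ⁻¹ᵁ W)) α =
      unitSectionLE π' N₀ (preimage_inf_face_le hsq U i α)
        ((show Γ(Cech.obj U n N₀, g₀ ⁻¹ᵁ V) from m : Cech.Sections U n N₀ (g₀ ⁻¹ᵁ V)) α) := by
  -- Step 1: move the restriction `|_W` outside and use the transpose formula over `q⁻¹V`.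
  have h1 : (baseChangeHom hsq U N₀ n).app W (unitSectionLE q _ i m) =
      ((Scheme.Modules.pushforward g').obj (Cech.obj (Cech.preimageFamily π' U) n
        ((Scheme.Modules.pullback π').obj N₀))).presheaf.map (homOfLE i).op ((baseChangeFlat hsq U N₀ n).app V m) := by
    rw [unitSectionLE, Scheme.Modules.Hom.app_map_apply, baseChangeHom_app_unitSection]
  -- Step 2: `baseChangeFlat = exchange ∘ g₀_*(unitHom)` on sections.
  have h2 : (baseChangeFlat hsq U N₀ n).app V m =
      (Cech.obj (Cech.preimageFamily π' U) n ((Scheme.Modules.pullback π').obj N₀)).presheaf.map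
        (eqToHom (show g' ⁻¹ᵁ (q ⁻¹ᵁ V) = π' ⁻¹ᵁ (g₀ ⁻¹ᵁ V) by
          rw [← Scheme.Hom.comp_preimage, ← Scheme.Hom.comp_preimage, hsq.w])).op
        ((Cech.unitHom U N₀ π' n).app (g₀ ⁻¹ᵁ V) m) := by
    rw [baseChangeFlat, Scheme.Modules.Hom.comp_app, CategoryTheory.comp_apply, Scheme.Modules.pushforward_map_app]
    exact exchangeIso_hom_app_app hsq _ V _
  rw [h1, h2]
  -- Step 3: componentwise, everything is a restriction of `η_{π'}(m_α)`.
  set y := (Cech.unitHom U N₀ π' n).app (g₀ ⁻¹ᵁ V) m with hy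
  have h3 := Cech.pushforwardObjHom_app_unitHom_app U N₀ π' n (g₀ ⁻¹ᵁ V) m α
  rw [Cech.pushforwardObjHom_app_apply, ← hy] at h3
  -- both sides are restrictions of `y_α`
  change Cech.res ((Scheme.Modules.pullback π').obj N₀) _ (Cech.res ((Scheme.Modules.pullback π').obj N₀) _
    ((show Γ(Cech.obj (Cech.preimageFamily π' U) n ((Scheme.Modules.pullback π').obj N₀), π' ⁻¹ᵁ (g₀ ⁻¹ᵁ V)) from y :
      Cech.Sections (Cech.preimageFamily π' U) n ((Scheme.Modules.pullback π').obj N₀) (π' ⁻¹ᵁ (g₀ ⁻¹ᵁ V))) α)) = _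
  rw [Cech.res_res, unitSectionLE, ← h3]
  change _ = Cech.res ((Scheme.Modules.pullback π').obj N₀) _ (Cech.res ((Scheme.Modules.pullback π').obj N₀) _ _)
  rw [Cech.res_res]

end Comparison

end Literature.AlgebraicGeometry.Modules

end
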